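import Mathlib
import Summits.NavierStokesRegularity.NavierStokesRegularity.Theorems.RootDecompLitSliceMeanFieldEnergyDrop
import Summits.NavierStokesRegularity.NavierStokesRegularity.Theorems.RootDecompLitSliceMeanFieldBootstrapMap
import Summits.NavierStokesRegularity.NavierStokesRegularity.Theorems.RootDecompLitSliceMeanFieldClockRigidity
import HarnessLib

/-!
# Mean-field lever, one-step toolkit VI: THE ONE-STEP ESTIMATE (discharge of the mean-field antecedent)

Helper file for the crux `RootDecompLitSlice.CritTameScarIsCritical` (Uᶜ, stmt-…-31733). It assembles the
toolkit files `…Trilinear`, `…TimeSide`, `…SliceCurrency`, `…Pairing`, `…OneStep`, `…EnergyDrop` and the exponent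
bookkeeping of `…BootstrapMap` / `…ClockRigidity` into the ONE-STEP ESTIMATE, i.e. it DISCHARGES the
mean-field antecedent («one-step schema») of `MeanFieldBootstrap.critTameScar_lt_one_of_meanFieldStep`,
`MeanFieldClockRigidity.clockExponent_le_half_of_meanFieldStep` and the other `…_of_meanFieldStep` consumers:

> on the classical tame frame with a clock `∫‖u t − u T‖² ≤ K (T − t)^b`, `1/2 ≤ b ≤ 1`, an energy law
> `∫‖u t‖² − ∫‖u T‖² ≤ C (T − t)^a`, `b/2 ≤ a ≤ 1/2`, improves itself to the law with exponent
> `min b Ψ_b(a)`, `Ψ_b(a) = b(3+a−b)/(2(2+b−2a))`; at `b = 1/2`: `Ψ(a) = (5 + 2a)/(4(5 − 4a)) > a`.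

## Contents

* §1 `meanFieldStep_b` — the one-step estimate at clock exponent `b` (`1/2 ≤ b`, `b/2 ≤ a ≤ 1/2`). Given `t`
  in a short window, put `τ = T − t`, `σ = τ^{μ⋆}`, `μ⋆ = (1+3a−2b)/(2+b−2a) ∈ (0, 1]`; choose the comparison
  slice `s₀ ∈ (T − σ, T − σ/2)` by Chebyshev (`MeanFieldTimeSide.exists_slice_dissipation_le`:
  `F(s₀) ≤ C σ^{a−1}/ν`); the window slices are `L²`-close to it by the clock (`ℓ = 2 √K σ^{b/2}`);
  `MeanFieldEnergyDrop.energyDrop_le` + `MeanFieldOneStep.abs_integral_flux_le` give the five-term bound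
  `K τ^b + A₁ τ^{e₁} + A₂ τ^{e₂a} + A₃ τ^{e₂b} + A₄ τ^{e₃}` — literally the hypothesis of
  `MeanFieldClockRigidity.step_of_termBounds_b`, which returns the law `min b Ψ_b(a)`.
* §2 `meanFieldStep` — the `√`-clock case `b = 1/2`, `1/4 ≤ a ≤ 1/2`, in the literal shape of the antecedent
  `hstep` of `RootDecompLitSliceMeanFieldBootstrap` (exponent `(5 + 2a)/(4(5 − 4a))`).

HONEST FRAMING: helpers INSIDE the zero-load cell Uᶜ (ROOT ⟺ Uᵃ ∧ P1 unchanged); nothing here proves NS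
regularity. All statements are over accepted `Literature.Analysis.FluidPDE` declarations and Mathlib; no new
definitions. [cite: ConstantinFoias1988, Ch. 6, Ch. 8; Galdi2000, Lemma 2.1]
-/

set_option linter.dupNamespace false

namespace Summit.NavierStokesRegularity.NavierStokesRegularity.Theorems

open MeasureTheory Set Filter Topology Function Module
open scoped ENNReal NNReal RealInnerProductSpace
open Literature.Analysis.FluidPDE

namespace MeanFieldOneStepAssembly

variable {ν T : ℝ} {u : ℝ → EuclideanSpace ℝ (Fin 3) → EuclideanSpace ℝ (Fin 3)}
  {p : ℝ → EuclideanSpace ℝ (Fin 3) → ℝ}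

/-! ## §1 The one-step estimate at a general clock exponent `b ∈ [1/2, 1]` -/

/-- **THE ONE-STEP ESTIMATE at a general clock exponent `b ∈ [1/2, 1]`.** On the classical tame frame
(`ν > 0`, classical on `[0, T) × ℝ³`, Leray–Hopf on `[0, T]` from `u 0`) with a clock
`∫‖u t − u T‖² ≤ K (T − t)^b` near `T`: an energy law `∫‖u t‖² − ∫‖u T‖² ≤ C (T − t)^a` with
`b/2 ≤ a ≤ 1/2` improves itself to the law with exponent `min b Ψ_b(a)`, `Ψ_b(a) = b(3+a−b)/(2(2+b−2a))`.
Proof = the blueprint: comparison slice `w = u s₀`, `s₀ ∈ (T − σ, T − σ/2)` chosen by Chebyshev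
(`exists_slice_dissipation_le`) at the intermediate scale `σ = τ^{μ⋆}`, `μ⋆ = (1+3a−2b)/(2+b−2a) ∈ (0, 1]`;
energy drop through `w` (`energyDrop_le`); pairing identity + pointwise flux bound + window power means
(`MeanFieldOneStep.abs_integral_flux_le`); the resulting five-term bound is exactly the hypothesis of the landed
exponent bookkeeping `MeanFieldClockRigidity.step_of_termBounds_b`. This discharges the one inserted antecedent
of `MeanFieldClockRigidity.no_clock_above_half_of_meanFieldStep` / `clockExponent_le_half_of_meanFieldStep`.
[folklore] -/
theorem meanFieldStep_b {b : ℝ} (hν : 0 < ν) (hT : 0 < T)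
    (hcl : IsClassicalNSSolutionOn (Ico 0 T) ν 0 u p) (hLH : IsLerayHopfOn T ν 0 (u 0) u)
    (hclock : ∃ K T₁ : ℝ, T₁ < T ∧ ∀ t ∈ Ioo T₁ T,
      ∫⁻ x, ‖u t x - u T x‖ₑ ^ 2 ≤ ENNReal.ofReal (K * (T - t) ^ b))
    (hb : 1 / 2 ≤ b) {a : ℝ} (hab : b / 2 ≤ a) (ha : a ≤ 1 / 2)
    (hlaw : ∃ C T₂ : ℝ, T₂ < T ∧ ∀ t ∈ Ioo T₂ T,
      (∫ x, ‖u t x‖ ^ 2) - ∫ x, ‖u T x‖ ^ 2 ≤ C * (T - t) ^ a) :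
    ∃ C T₂ : ℝ, T₂ < T ∧ ∀ t ∈ Ioo T₂ T,
      (∫ x, ‖u t x‖ ^ 2) - ∫ x, ‖u T x‖ ^ 2 ≤
        C * (T - t) ^ min b (b * (3 + a - b) / (2 * (2 + b - 2 * a))) := by
  have ha0 : 0 < a := by linarith
  have hb0 : 0 < b := by linarith
  -- two scalar conversions used below
  have hsqrt_rpow : ∀ {x : ℝ}, 0 ≤ x → ∀ e : ℝ, Real.sqrt (x ^ e) = x ^ (e / 2) := by
    intro x hx e; rw [Real.sqrt_eq_rpow, ← Real.rpow_mul hx]; congr 1; ring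
  have hL2sqrt : ∀ {f : EuclideanSpace ℝ (Fin 3) → EuclideanSpace ℝ (Fin 3)} {c : ℝ}, 0 ≤ c →
      (∫⁻ x, ‖f x‖ₑ ^ 2 ≤ ENNReal.ofReal c) → eLpNorm f 2 volume ≤ ENNReal.ofReal (Real.sqrt c) := by
    intro f c hc h
    rw [eLpNorm_eq_lintegral_rpow_enorm_toReal two_ne_zero ENNReal.ofNat_ne_top, ENNReal.toReal_ofNat,
      Real.sqrt_eq_rpow, ← ENNReal.ofReal_rpow_of_nonneg hc (by norm_num)]
    refine ENNReal.rpow_le_rpow ?_ (by norm_num)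
    refine le_of_eq_of_le (lintegral_congr fun x => ?_) h
    rw [show (2 : ℝ) = (2 : ℕ) by norm_num, ENNReal.rpow_natCast]
  obtain ⟨K, T₁, hT₁, hK⟩ := hclock
  obtain ⟨C, T₂, hT₂, hC⟩ := hlaw
  -- nonnegative constants
  set K' : ℝ := max K 0 with hK'def
  set C' : ℝ := max C 0 with hC'def
  have hK'0 : 0 ≤ K' := le_max_right _ _
  have hC'0 : 0 ≤ C' := le_max_right _ _
  have hK' : ∀ t ∈ Ioo T₁ T, ∫⁻ x, ‖u t x - u T x‖ₑ ^ 2 ≤ ENNReal.ofReal (K' * (T - t) ^ b) :=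
    fun t ht => (hK t ht).trans (ENNReal.ofReal_le_ofReal
      (mul_le_mul_of_nonneg_right (le_max_left _ _) (Real.rpow_nonneg (by linarith [ht.2]) _)))
  have hC' : ∀ t ∈ Ioo T₂ T, (∫ x, ‖u t x‖ ^ 2) - ∫ x, ‖u T x‖ ^ 2 ≤ C' * (T - t) ^ a :=
    fun t ht => (hC t ht).trans (mul_le_mul_of_nonneg_right (le_max_left _ _)
      (Real.rpow_nonneg (by linarith [ht.2]) _))
  -- the intermediate scale exponent
  set μ : ℝ := (1 + 3 * a - 2 * b) / (2 + b - 2 * a) with hμdef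
  have hμ0 : 0 < μ := MeanFieldClockRigidity.muStar_pos hab ha hb
  have hμ1 : μ ≤ 1 := MeanFieldClockRigidity.muStar_le_one ha hb
  -- the window
  set T₀ : ℝ := max (max T₁ T₂) 0 with hT₀def
  have hT₀T : T₀ < T := max_lt (max_lt hT₁ hT₂) hT
  have hT₀1 : T₁ ≤ T₀ := (le_max_left _ _).trans (le_max_left _ _)
  have hT₀2 : T₂ ≤ T₀ := (le_max_right _ _).trans (le_max_left _ _)
  have hT₀0 : 0 ≤ T₀ := le_max_right _ _
  set ρ : ℝ := min 1 (T - T₀) with hρdef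
  have hρ0 : 0 < ρ := lt_min one_pos (sub_pos.2 hT₀T)
  have hρ1 : ρ ≤ 1 := min_le_left _ _
  have hρT : ρ ≤ T - T₀ := min_le_right _ _
  set δ : ℝ := ρ ^ (1 / μ) with hδdef
  have hδ0 : 0 < δ := Real.rpow_pos_of_pos hρ0 _
  have hδρ : δ ≤ ρ := by
    have h := Real.rpow_le_rpow_of_exponent_ge hρ0 hρ1 (show (1 : ℝ) ≤ 1 / μ by
      rw [le_div_iff₀ hμ0]; linarith)
    rwa [Real.rpow_one] at h
  -- the Sobolev constant and the coefficients
  set κ : ℝ := (SNormLESNormFDerivOfEqConst (EuclideanSpace ℝ (Fin 3))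
    (volume : Measure (EuclideanSpace ℝ (Fin 3))) 2 : ℝ) with hκ
  have hκ0 : 0 ≤ κ := NNReal.coe_nonneg _
  have hCν : 0 ≤ C' / ν := div_nonneg hC'0 hν.le
  have hC2ν : 0 ≤ C' / (2 * ν) := div_nonneg hC'0 (by positivity)
  set A₁ : ℝ := 2 * (Real.sqrt K' * Real.sqrt K') with hA₁
  set A₂ : ℝ := 2 * ((2 * Real.sqrt K') ^ (1 / 2 : ℝ) * κ ^ (1 / 2 : ℝ) * (C' / ν) ^ (1 / 2 : ℝ) * κ *
    (C' / (2 * ν)) ^ (3 / 4 : ℝ)) with hA₂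
  set A₃ : ℝ := 2 * ((2 * Real.sqrt K') ^ (1 / 2 : ℝ) * κ ^ (1 / 2 : ℝ) * (C' / ν) ^ (1 / 2 : ℝ) * κ *
    (C' / ν) ^ (1 / 4 : ℝ) * (C' / (2 * ν)) ^ (1 / 2 : ℝ)) with hA₃
  set A₄ : ℝ := 2 * (ν * (C' / ν) ^ (1 / 2 : ℝ) * (C' / (2 * ν)) ^ (1 / 2 : ℝ)) with hA₄
  refine ⟨_, T - δ, by linarith, MeanFieldClockRigidity.step_of_termBounds_b (K := K') (A₁ := A₁)
    (A₂ := A₂) (A₃ := A₃) (A₄ := A₄) (D := fun t => (∫ x, ‖u t x‖ ^ 2) - ∫ x, ‖u T x‖ ^ 2) ha hb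
    (T₂ := T - δ) (by linarith) ?_⟩
  intro t ht
  -- the two scales
  set τ : ℝ := T - t with hτdef
  have hτ : 0 < τ := by simp only [hτdef]; linarith [ht.2]
  have hτδ : τ < δ := by simp only [hτdef]; linarith [ht.1]
  have hτ1 : τ ≤ 1 := by linarith
  set σ : ℝ := τ ^ μ with hσdef
  have hσ : 0 < σ := Real.rpow_pos_of_pos hτ _
  have hσρ : σ < ρ := by
    have h := Real.rpow_lt_rpow hτ.le hτδ hμ0
    rwa [hδdef, ← Real.rpow_mul hρ0.le, one_div_mul_cancel hμ0.ne', Real.rpow_one] at h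
  have hτσ : τ ≤ σ := by
    have h := Real.rpow_le_rpow_of_exponent_ge hτ hτ1 hμ1
    rwa [Real.rpow_one] at h
  have hσ1 : σ ≤ 1 := by linarith
  have hσT₀ : T₀ < T - σ := by linarith
  have hσT : σ ≤ T := by linarith
  have ht0 : 0 < t := by
    have : T - δ ≥ T₀ := by linarith
    linarith [ht.1]
  have htI : t ∈ Ioo 0 T := ⟨ht0, ht.2⟩
  have ht1 : t ∈ Ioo T₁ T := ⟨by linarith [ht.1], ht.2⟩
  have ht2 : t ∈ Ioo T₂ T := ⟨by linarith [ht.1], ht.2⟩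
  -- the comparison slice
  obtain ⟨s₀, hs₀, hF₀⟩ := MeanFieldTimeSide.exists_slice_dissipation_le hν hT hcl hLH hσ hσT
  have hs₀I : s₀ ∈ Ioo 0 T := ⟨by linarith [hs₀.1], by linarith [hs₀.2]⟩
  have hs₀1 : s₀ ∈ Ioo T₁ T := ⟨by linarith [hs₀.1], hs₀I.2⟩
  have hTs₀ : T - s₀ ≤ σ := by linarith [hs₀.1]
  have hTσ2 : T - σ ∈ Ioo T₂ T := ⟨by linarith, by linarith⟩
  -- `m`: the dissipation of the comparison slice
  set m : ℝ := C' / ν * σ ^ (a - 1) with hmdef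
  have hm0 : 0 ≤ m := mul_nonneg hCν (Real.rpow_nonneg hσ.le _)
  have hM : (∫⁻ x, ENNReal.ofReal (frobeniusNormSq (fderiv ℝ (u s₀) x))) ≤ ENNReal.ofReal m := by
    refine hF₀.trans (ENNReal.ofReal_le_ofReal ?_)
    have h1 := hC' (T - σ) hTσ2
    rw [show T - (T - σ) = σ by ring] at h1
    calc ((∫ x, ‖u (T - σ) x‖ ^ 2) - ∫ x, ‖u T x‖ ^ 2) / (ν * σ) ≤ C' * σ ^ a / (ν * σ) :=
          div_le_div_of_nonneg_right h1 (by positivity)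
      _ = m := by
          rw [hmdef, Real.rpow_sub_one hσ.ne']
          field_simp
  have hMfin : (∫⁻ x, ENNReal.ofReal (frobeniusNormSq (fderiv ℝ (u s₀) x))) ≠ ⊤ :=
    (hM.trans_lt ENNReal.ofReal_lt_top).ne
  -- `ℓ`: the `L²`-closeness of the window slices to the comparison slice
  set Sb : ℝ := σ ^ (b / 2) with hSb
  set ℓ : ℝ := 2 * (Real.sqrt K' * Sb) with hℓdef
  have hSb0 : 0 ≤ Sb := Real.rpow_nonneg hσ.le _
  have hℓ0 : 0 ≤ ℓ := by positivity
  have hclk : ∀ s ∈ Ioo T₁ T, T - s ≤ σ →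
      eLpNorm (fun x => u s x - u T x) 2 volume ≤ ENNReal.ofReal (Real.sqrt K' * Sb) := by
    intro s hs hsσ
    have hTs : 0 ≤ T - s := by linarith [hs.2]
    refine (hL2sqrt (by positivity) (hK' s hs)).trans (ENNReal.ofReal_le_ofReal ?_)
    rw [Real.sqrt_mul hK'0, hSb, ← hsqrt_rpow hσ.le]
    exact mul_le_mul_of_nonneg_left (Real.sqrt_le_sqrt (Real.rpow_le_rpow hTs hsσ hb0.le))
      (Real.sqrt_nonneg _)
  have hL : ∀ s ∈ Ioo t T, eLpNorm (fun x => u s x - u s₀ x) 2 volume ≤ ENNReal.ofReal ℓ := by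
    intro s hs
    have hs1 : s ∈ Ioo T₁ T := ⟨ht1.1.trans hs.1, hs.2⟩
    have hsσ : T - s ≤ σ := by linarith [hs.1]
    have hsplit : (fun x => u s x - u s₀ x) =
        fun x => (u s x - u T x) + (u T x - u s₀ x) := by
      funext x; rw [sub_add_sub_cancel]
    have hneg : (fun x => u T x - u s₀ x) = -(fun x => u s₀ x - u T x) := by
      funext x; simp
    have hmeas : ∀ r ∈ Icc 0 T, AEStronglyMeasurable (u r) volume := fun r hr => (hLH.memLp r hr).1
    have h1 := hclk s hs1 hsσ
    have h2 : eLpNorm (fun x => u T x - u s₀ x) 2 volume ≤ ENNReal.ofReal (Real.sqrt K' * Sb) := by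
      rw [hneg, eLpNorm_neg]; exact hclk s₀ hs₀1 hTs₀
    rw [hsplit]
    refine (eLpNorm_add_le ((hmeas s ⟨(ht0.trans hs.1).le, hs.2.le⟩).sub (hmeas T ⟨hT.le, le_rfl⟩))
      ((hmeas T ⟨hT.le, le_rfl⟩).sub (hmeas s₀ ⟨hs₀I.1.le, hs₀I.2.le⟩)) (by norm_num)).trans ?_
    rw [hℓdef, two_mul, ENNReal.ofReal_add (by positivity) (by positivity)]
    exact add_le_add h1 h2
  -- `d`: the energy drop at `t`
  set d : ℝ := C' * τ ^ a with hddef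
  have hd0 : 0 ≤ d := mul_nonneg hC'0 (Real.rpow_nonneg hτ.le _)
  have hD : (∫ x, ‖u t x‖ ^ 2) - ∫ x, ‖u T x‖ ^ 2 ≤ d := hC' t ht2
  -- the two master inequalities
  have hE := MeanFieldEnergyDrop.energyDrop_le hν hT hcl hLH htI hs₀I hMfin (α := K' * τ ^ b) (β := K' * σ ^ b)
    (by positivity) (by positivity) (hK' t ht1)
    ((hK' s₀ hs₀1).trans (ENNReal.ofReal_le_ofReal
      (mul_le_mul_of_nonneg_left (Real.rpow_le_rpow (by linarith [hs₀I.2]) hTs₀ hb0.le) hK'0)))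
  have hF := MeanFieldOneStep.abs_integral_flux_le hν hcl hLH htI hs₀I hMfin hℓ0 hm0 hd0 hL hM hD
  -- ### exponent algebra: atoms
  have hστ : ∀ e : ℝ, σ ^ e = τ ^ (μ * e) := fun e => by rw [hσdef, ← Real.rpow_mul hτ.le]
  have hα : Real.sqrt (K' * τ ^ b) = Real.sqrt K' * τ ^ (b / 2) := by
    rw [Real.sqrt_mul hK'0, hsqrt_rpow hτ.le]
  have hβ : Real.sqrt (K' * σ ^ b) = Real.sqrt K' * Sb := by
    rw [Real.sqrt_mul hK'0, hSb, hsqrt_rpow hσ.le]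
  have hℓhalf : ℓ ^ (1 / 2 : ℝ) = (2 * Real.sqrt K') ^ (1 / 2 : ℝ) * σ ^ (b / 4) := by
    rw [hℓdef, show 2 * (Real.sqrt K' * Sb) = (2 * Real.sqrt K') * Sb by ring,
      Real.mul_rpow (by positivity) hSb0, hSb, ← Real.rpow_mul hσ.le]
    congr 2; ring
  have hmhalf : m ^ (1 / 2 : ℝ) = (C' / ν) ^ (1 / 2 : ℝ) * σ ^ ((a - 1) / 2) := by
    rw [hmdef, Real.mul_rpow hCν (Real.rpow_nonneg hσ.le _), ← Real.rpow_mul hσ.le]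
    congr 2; ring
  have hmquarter : m ^ (1 / 4 : ℝ) = (C' / ν) ^ (1 / 4 : ℝ) * σ ^ ((a - 1) / 4) := by
    rw [hmdef, Real.mul_rpow hCν (Real.rpow_nonneg hσ.le _), ← Real.rpow_mul hσ.le]
    congr 2; ring
  have hdν : d / (2 * ν) = C' / (2 * ν) * τ ^ a := by rw [hddef]; ring
  have hd34 : (d / (2 * ν)) ^ (3 / 4 : ℝ) = (C' / (2 * ν)) ^ (3 / 4 : ℝ) * τ ^ (3 * a / 4) := by
    rw [hdν, Real.mul_rpow hC2ν (Real.rpow_nonneg hτ.le _), ← Real.rpow_mul hτ.le]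
    congr 2; ring
  have hd12 : (d / (2 * ν)) ^ (1 / 2 : ℝ) = (C' / (2 * ν)) ^ (1 / 2 : ℝ) * τ ^ (a / 2) := by
    rw [hdν, Real.mul_rpow hC2ν (Real.rpow_nonneg hτ.le _), ← Real.rpow_mul hτ.le]
    congr 2; ring
  -- ### exponent algebra: monomials
  have hm1 : τ ^ (b / 2) * Sb = τ ^ (b / 2 * (1 + μ)) := by
    rw [hSb, hστ, ← Real.rpow_add hτ]; congr 1; ring
  have hm2a : σ ^ (b / 4) * σ ^ ((a - 1) / 2) * (τ ^ (1 / 4 : ℝ) * τ ^ (3 * a / 4)) =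
      τ ^ ((1 + 3 * a) / 4 + μ * (b / 4 - (1 - a) / 2)) := by
    rw [hστ, hστ, ← Real.rpow_add hτ, ← Real.rpow_add hτ, ← Real.rpow_add hτ]; congr 1; ring
  have hm2b : σ ^ (b / 4) * σ ^ ((a - 1) / 2) * σ ^ ((a - 1) / 4) * (τ ^ (1 / 2 : ℝ) * τ ^ (a / 2)) =
      τ ^ ((1 + a) / 2 + μ * (b / 4 - 3 * (1 - a) / 4)) := by
    rw [hστ, hστ, hστ, ← Real.rpow_add hτ, ← Real.rpow_add hτ, ← Real.rpow_add hτ,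
      ← Real.rpow_add hτ]; congr 1; ring
  have hm3 : σ ^ ((a - 1) / 2) * (τ ^ (1 / 2 : ℝ) * τ ^ (a / 2)) =
      τ ^ ((1 + a) / 2 - μ * ((1 - a) / 2)) := by
    rw [hστ, ← Real.rpow_add hτ, ← Real.rpow_add hτ]; congr 1; ring
  -- ### assemble
  have hfinal : K' * τ ^ b + 2 * (Real.sqrt (K' * τ ^ b) * Real.sqrt (K' * σ ^ b)) +
      2 * (ℓ ^ (1 / 2 : ℝ) * κ ^ (1 / 2 : ℝ) * m ^ (1 / 2 : ℝ) * κ *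
        (τ ^ (1 / 4 : ℝ) * (d / (2 * ν)) ^ (3 / 4 : ℝ) +
          m ^ (1 / 4 : ℝ) * (τ ^ (1 / 2 : ℝ) * (d / (2 * ν)) ^ (1 / 2 : ℝ))) +
        ν * m ^ (1 / 2 : ℝ) * (τ ^ (1 / 2 : ℝ) * (d / (2 * ν)) ^ (1 / 2 : ℝ))) =
      K' * τ ^ b + A₁ * τ ^ (b / 2 * (1 + μ)) +
        A₂ * τ ^ ((1 + 3 * a) / 4 + μ * (b / 4 - (1 - a) / 2)) +
        A₃ * τ ^ ((1 + a) / 2 + μ * (b / 4 - 3 * (1 - a) / 4)) +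
        A₄ * τ ^ ((1 + a) / 2 - μ * ((1 - a) / 2)) := by
    rw [← hm1, ← hm2a, ← hm2b, ← hm3, hα, hβ, hℓhalf, hmhalf, hmquarter, hd34, hd12]
    simp only [hA₁, hA₂, hA₃, hA₄]
    ring
  have hgoal : (∫ x, ‖u t x‖ ^ 2) - ∫ x, ‖u T x‖ ^ 2 ≤
      K' * τ ^ b + 2 * (Real.sqrt (K' * τ ^ b) * Real.sqrt (K' * σ ^ b)) +
      2 * (ℓ ^ (1 / 2 : ℝ) * κ ^ (1 / 2 : ℝ) * m ^ (1 / 2 : ℝ) * κ *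
        (τ ^ (1 / 4 : ℝ) * (d / (2 * ν)) ^ (3 / 4 : ℝ) +
          m ^ (1 / 4 : ℝ) * (τ ^ (1 / 2 : ℝ) * (d / (2 * ν)) ^ (1 / 2 : ℝ))) +
        ν * m ^ (1 / 2 : ℝ) * (τ ^ (1 / 2 : ℝ) * (d / (2 * ν)) ^ (1 / 2 : ℝ))) := by
    linarith [hE, hF]
  rw [hfinal] at hgoal
  simpa only [hτdef, hμdef] using hgoal

/-! ## §2 The `√`-clock case `b = 1/2`: the antecedent `hstep` of `MeanFieldBootstrap` -/

/-- **THE ONE-STEP ESTIMATE, `b = 1/2`.** On the classical tame frame with the `√`-clock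
`∫‖u t − u T‖² ≤ K √(T − t)`: an energy law of exponent `a ∈ [1/4, 1/2]` improves itself to the law with
exponent `Ψ(a) = (5 + 2a)/(4(5 − 4a))` — the antecedent `hstep` of
`MeanFieldBootstrap.critTameScar_lt_one_of_meanFieldStep` and of the other `…_of_meanFieldStep` consumers of
`RootDecompLitSliceMeanFieldBootstrap` (there with `a < 1/2`). [folklore] -/
theorem meanFieldStep (hν : 0 < ν) (hT : 0 < T)
    (hcl : IsClassicalNSSolutionOn (Ico 0 T) ν 0 u p) (hLH : IsLerayHopfOn T ν 0 (u 0) u)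
    (hclock : ∃ K T₁ : ℝ, T₁ < T ∧ ∀ t ∈ Ioo T₁ T,
      ∫⁻ x, ‖u t x - u T x‖ₑ ^ 2 ≤ ENNReal.ofReal (K * Real.sqrt (T - t)))
    {a : ℝ} (ha1 : 1 / 4 ≤ a) (ha : a ≤ 1 / 2)
    (hlaw : ∃ C T₂ : ℝ, T₂ < T ∧ ∀ t ∈ Ioo T₂ T,
      (∫ x, ‖u t x‖ ^ 2) - ∫ x, ‖u T x‖ ^ 2 ≤ C * (T - t) ^ a) :
    ∃ C T₂ : ℝ, T₂ < T ∧ ∀ t ∈ Ioo T₂ T,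
      (∫ x, ‖u t x‖ ^ 2) - ∫ x, ‖u T x‖ ^ 2 ≤ C * (T - t) ^ ((5 + 2 * a) / (4 * (5 - 4 * a))) := by
  have hclock' : ∃ K T₁ : ℝ, T₁ < T ∧ ∀ t ∈ Ioo T₁ T,
      ∫⁻ x, ‖u t x - u T x‖ₑ ^ 2 ≤ ENNReal.ofReal (K * (T - t) ^ (1 / 2 : ℝ)) := by
    obtain ⟨K, T₁, hT₁, hK⟩ := hclock
    exact ⟨K, T₁, hT₁, fun t ht => by rw [← Real.sqrt_eq_rpow]; exact hK t ht⟩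
  have h := meanFieldStep_b hν hT hcl hLH hclock' (b := 1 / 2) le_rfl (by linarith) ha hlaw
  have hΨ : min (1 / 2 : ℝ) (1 / 2 * (3 + a - 1 / 2) / (2 * (2 + 1 / 2 - 2 * a))) =
      (5 + 2 * a) / (4 * (5 - 4 * a)) := by
    have h1 : (1 / 2 : ℝ) * (3 + a - 1 / 2) / (2 * (2 + 1 / 2 - 2 * a)) =
        (5 + 2 * a) / (4 * (5 - 4 * a)) := by
      rw [div_eq_div_iff (by linarith) (by linarith)]; ring
    rw [h1]; exact min_eq_right (MeanFieldBootstrap.psi_le_half ha)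
  simpa only [hΨ] using h

end MeanFieldOneStepAssembly
end Summit.NavierStokesRegularity.NavierStokesRegularity.Theorems
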